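import Summits.Ventures.PercRepro.S1LadderCells
import Summits.Ventures.PercRepro.S1SeriesLever

/-!
# PercRepro — THE CELL `(10, 9)` OF THE `q = 4` WINDOW (p2, gen 21; SUBCLAIM-S1 §6.5 (iv))

The cell `(10, 9)` (`1.0292` under the plain lever: it needs `s₄ ≤ 114` on `19` points where the lever gives `125`), by
the COLOOP LADDER (S1LadderCells) with the ITERATED SERIES-CLASS LEVER on the coloop-free case: `s₄ ≤ gb 9 19 = 111`
(S1SeriesLever), `s₃ ≤ 15`, `s₅ ≤ 883` — `0.9886`; one or two coloops at `0.7031 / 0.5556` on the plain lever caps with the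
credit `2^{18} − W₃⁺(18)` (…); `c ≥ 3` coloops by the lossy ladder (`2(2^3 − 1) = 14 ≥ Φ(10, 4) = 13.43`). Exact-rational
twin mining/p2/g21/gencells.py. The row `p = 10` now reads `5 ≤ d ≤ 8`.

* `phiK_ten_four_le` — `Φ(10, 4) ≤ 14`; `gb_cap_nine_nineteen` — the series-class cap instantiated;
* **`c025_core_ten_nine`**.
Axioms: standard.
-/

open scoped Matroid

namespace PercRepro

namespace S1

open Set

variable {α : Type}

/-- `Φ(10, 4) = 13442/1001 ≤ 14`. -/
theorem phiK_ten_four_le : phiK 10 4 ≤ 2 * ((2 : ℚ) ^ 3 - 1) := by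
  simp only [phiK]
  rw [show Finset.Ioo 4 10 = {5, 6, 7, 8, 9} by decide]
  norm_num [Finset.sum_insert, Finset.sum_singleton, Finset.sum_div, Nat.choose]

/-- **The series-class cap at `(9, 19)`**: a coloop-free `e`-free core of nullity `9` on `19` points has `s₄ ≤ 111`. -/
theorem gb_cap_nine_nineteen : ∀ (N : Matroid α) [N.Finite],
    (∀ e ∈ N.E, ∃ A ⊆ N.E \ {e}, e ∉ N.closure A ∧ e ∉ N.closure ((N.E \ {e}) \ A)) →
    N.E.encard = N.eRank + ((9 : ℕ) : ℕ∞) → N.E.ncard = 10 + 9 → N.coloops = ∅ →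
    {C : Set α | N.IsCircuit C ∧ C.ncard = 4}.ncard ≤ 111 := by
  intro N _ hfree hd hn hcol
  have h := ncard_fourCircuits_le_gb_of_coloopFree N hfree hd hcol hn
  rwa [show gb 9 (10 + 9) = 111 from gb_values.1] at h

/-- **THE CELL `(10, 9)`**: an `e`-free core of rank `10` with `19` points satisfies `RLS` at level `4` — by the
coloop ladder: `c = 0` on the series-class cap `111`, `c = 1, 2` on the lever caps, `c ≥ 3` by the lossy ladder. -/
theorem c025_core_ten_nine (M : Matroid α) [M.Finite] (hR : M.eRank = (10 : ℕ)) (hn : M.E.ncard = 19)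
    (hfree : ∀ e ∈ M.E, ∃ A ⊆ M.E \ {e}, e ∉ M.closure A ∧ e ∉ M.closure ((M.E \ {e}) \ A)) :
    ThmN.RLS M 10 4 := by
  rcases (show M.coloops.ncard = 0 ∨ M.coloops.ncard = 1 ∨ M.coloops.ncard = 2 ∨ 3 ≤ M.coloops.ncard by omega)
    with h | h | h | h
  · exact rls_of_ladder_case_cap M (p := 10) (c := 0) (d := 9) (by norm_num) (by norm_num) hR hn hfree h
      (by norm_num) (by norm_num) (P := 15) (S := 111) (S5 := 883) (by decide) gb_cap_nine_nineteen (by decide)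
      (by decide +kernel)
  · exact rls_of_ladder_case M (p := 9) (c := 1) (d := 9) (by norm_num) (by norm_num) hR hn hfree h
      (by norm_num) (by norm_num) (P := 15) (S := 127) (S5 := 901) (by decide) (by decide) (by decide)
      (by decide +kernel)
  · exact rls_of_ladder_case M (p := 8) (c := 2) (d := 9) (by norm_num) (by norm_num) hR hn hfree h
      (by norm_num) (by norm_num) (P := 15) (S := 129) (S5 := 922) (by decide) (by decide) (by decide)
      (by decide +kernel)
  · exact rls_of_coloops_lossy M (p := 7) (c := 3) (hR.trans (by norm_num)) (by norm_num) h phiK_ten_four_le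

end S1

end PercRepro
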